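import Summits.AtomisticToContinuum.BoseEinsteinCondensation.Theses.BECModePrice
import Summits.AtomisticToContinuum.BoseEinsteinCondensation.Theorems.BECModePriceModePriceIntegrableStubNormSqDensityWave
import Summits.AtomisticToContinuum.BoseEinsteinCondensation.Theorems.BECModePriceModePriceIntegrableStubEnergyAddConst
import Summits.AtomisticToContinuum.BoseEinsteinCondensation.Theorems.BECModePriceModePriceIntegrableStubSwitchOfBoundedMode
import Summits.AtomisticToContinuum.BoseEinsteinCondensation.Theorems.BECModePriceModePriceIntegrableStubPriceOfSoftenedOccupation
import Literature.MathematicalPhysics.QuantumManyBody.PeriodicBoseGasFracEnergy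
import Literature.MathematicalPhysics.QuantumManyBody.BoseGasStructureFactor
import HarnessLib

/-!
# Crux `ModePriceIntegrable` (stmt-AtomisticToContinuum-18512), line `Sketch` — NOTCH-THE-VERTEX skeleton

Crux (route BECModePrice, verbatim the route decl): for every repulsive finite-range integrable
`v` there are `C, ρ₀ > 0` such that for `0 < ρ < ρ₀`, eventually in `N`, for all `p ≠ 0` and all
periodic trial states `Ψ` on the torus of side `L = (N/ρ)^{1/3}`:
`E₀^per + ½|2πp/L|² n_p(Ψ) ≤ ⟨Ψ,HΨ⟩ + Cρ` (single-mode softening price, SMS).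

Line `Sketch` = crux-ideate k1 (cards `notch-the-vertex` + `deexcitation-certificate`; the planner's
`Sketch.lean` is evidence-only and unreadable from a prover jail, so the skeleton is rebuilt here from
the two cards in `Cruxes/ModePriceIntegrable/Ideas/`).

THE CUT (card notch-the-vertex, "First lemma" `sms_of_notch`), RESHAPED after wave 1. Fix a mode
`m ≠ 0`, `k = 2πm/L`, and a coupling `t ≥ 0`. With the density wave `ρ_k(X) = ∑_j e^{ik·x_j}`
(`densityWave`) one has `|ρ_k|² = N + 2∑_{i<j} cos(k·(x_i-x_j))` (stub N, LANDED), hence the ENERGY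
BOOKKEEPING (stub A, LANDED) `E(Ψ) + tN²/L³ = F_t(Ψ) + M_t(Ψ)` with the two NON-NEGATIVE functionals
`M_t(Ψ) = (t/L³)∫|ρ_k|²|Ψ|²` (one collective coordinate) and
`F_t(Ψ) = E(Ψ) + (2t/L³)∫∑_{i<j}(1 - cos k·(x_i-x_j))|Ψ|²` (the gas whose pair interaction has its
torus Fourier coefficient at `±k` lowered by `t`, shifted to be non-negative). Then (glue
`sms_of_notch`, PROVED here): SWITCH `inf E + tN²/L³ ≤ inf F_t + C₁ρ` and NOTCHED PRICE
`inf F_t + ½k² n_k(Ψ) ≤ F_t(Ψ) + C₂ρ (∀Ψ)` give the crux body with `C₁ + C₂`. SWITCH follows (stub S,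
LANDED) from a bounded `M_t` on near-minimisers of `F_t` (stub F, OPEN), and NOTCHED PRICE follows
(stub P, LANDED) from a bounded half-price occupation of the near-minimisers of the SOFTENED notched
functional `F_t - ½k²n_k` (stub O, OPEN, hardest).

WHICH `t` (the reshape). The card notches the BARE coefficient, `t = v̂(k)⁺ → V₀ = ∫v` as `k → 0`;
wave 1 (worker on the then-registered `stub_notchedStructureFactor`) showed that stub FALSE for every
`v ≠ 0`: `H - (t/L³)|ρ_k|²` is a ferromagnetic Kac coupling of the phases `k·x_j`, and an LDA density
wave `n = ρ(1 + A cos k·x)` gains `(t/4)A²ρN` against an energy cost `2πaA²ρN + A²k²N/8`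
(Dyson–LSSY box-wise upper bound vs Lieb–Yngvason lower bound), so for `t > e₀''(ρ) = 8πa(1+O(√(ρa³)))`
and `k² < 2ρ(t - 8πa)` SWITCH `≥ ¼(t - 8πa)A²ρN` is EXTENSIVE (bare `V₀` vs renormalised `8πa`:
Spruch–Rosenberg `V₀ > 8πa` strictly). The stable notch is the RENORMALISED coupling: here
`t := 8π·a(v)` (`scatteringLength`, finite for integrable `v`). At `t = 8πa` the density-wave gain
is `≤ 0` to leading order (margin: quantum pressure `A²k²N/8` + the LHY stiffness
`e₀'' - 8πa = 8πa·(16/√π)√(ρa³) > 0`), the ladder-renormalised pairing/exchange vertex of the pair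
`±k` (`≈ 8πa` for `|k| ≪ 1/R₀`) is cancelled to leading order (the notched mode is a bare particle:
`e'_k = k²`, `S'(k) ≤ 1` at Bogoliubov level, SWITCH `≈ e_k - k² ≤ 8πaρ`), which is what stubs F and
O below assert quantitatively. Both remain OPEN (thermodynamic-limit correlation bounds at `O(ρ)` /
`O(1)`-per-mode precision); F sits at an LHY-order stability margin in the ultra-infrared.

Registered stubs (signatures def-free, self-contained, `open … in` prefixed):
* `stub_normSqDensityWave` (N) — LANDED p166277 (`…Theorems.BECModePriceModePriceIntegrableStubNormSqDensityWave`).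
* `stub_energyAddConst` (A) — LANDED p166390 (`…StubEnergyAddConst`).
* `stub_switch_of_boundedMode` (S) — LANDED p166071 (`…StubSwitchOfBoundedMode`).
* `stub_price_of_softenedOccupation` (P) — LANDED p166130 (`…StubPriceOfSoftenedOccupation`).
* `stub_gNotchedStructureFactor` (F, OPEN): near-minimisers of `F_t`, `t = 8πa`, with `M_t ≤ C₁ρ`.
* `stub_softenedGNotchedOccupation` (O, OPEN, hardest): near-minimisers of `F_t - ½k²n_k` with
  `½k²n_k ≤ C₂ρ`.
(Retired: `stub_notchedStructureFactor`, `stub_softenedNotchedOccupation` with `t = v̂(k)⁺` — the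
first is FALSE, see above; evidence `stub_notchedStructureFactor.lean` on the item.)
Composition `ModePriceIntegrable_of : N → A → S → P → F → O → ModePriceIntegrable` is sorry-free.

Disproof.lean: none exists for this crux (`ledger crux ls`: no Disproof), so there is no
`_false_without_` obligation; the refuter notes on the item are honoured: `∀ m` stays inside `∀ᶠ N`
in F and O (uniformity in the mode is load-bearing), the `v ≡ 0` instance stays true (`a = 0`,
`t = 0`, `M = 0`, `F = E`).
-/

noncomputable section

open MeasureTheory Filter
open scoped ENNReal NNReal

namespace Summit.AtomisticToContinuum.BoseEinsteinCondensation.Theorems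

open Literature.MathematicalPhysics.QuantumManyBody.BoseGas
open Summit.AtomisticToContinuum.BoseEinsteinCondensation.Theses.BECModePrice

/-! ## Legend: the stub statements as named propositions (verbatim the registered signatures) -/

/-- Statement of stub N (`stub_normSqDensityWave`). -/
def Sig.normSqDensityWave : Prop :=
  open MeasureTheory Literature.MathematicalPhysics.QuantumManyBody.BoseGas in ∀ (N : ℕ) (L : ℝ) (m : Fin 3 → ℤ) (X : Fin N → EuclideanSpace ℝ (Fin 3)), ‖densityWave N L m X‖ ^ 2 = (N : ℝ) + 2 * ∑ i : Fin N, ∑ j : Fin N with i < j, Real.cos (2 * Real.pi / L * ∑ r : Fin 3, (m r : ℝ) * (X i r - X j r))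

/-- Statement of stub A (`stub_energyAddConst`). -/
def Sig.energyAddConst : Prop :=
  open MeasureTheory Literature.MathematicalPhysics.QuantumManyBody.BoseGas in ∀ (v : ℝ → ENNReal) (N : ℕ) (L t : ℝ) (m : Fin 3 → ℤ), 0 < L → 0 ≤ t → (∀ X : Fin N → EuclideanSpace ℝ (Fin 3), ‖densityWave N L m X‖ ^ 2 = (N : ℝ) + 2 * ∑ i : Fin N, ∑ j : Fin N with i < j, Real.cos (2 * Real.pi / L * ∑ r : Fin 3, (m r : ℝ) * (X i r - X j r))) → ∀ Ψ : PeriodicTrialState N L, periodicEnergy v Ψ + ENNReal.ofReal (t * (N : ℝ) ^ 2 / L ^ 3) = (periodicEnergy v Ψ + ENNReal.ofReal (2 * t / L ^ 3) * ∫⁻ X in cellN N L, (∑ i : Fin N, ∑ j : Fin N with i < j, ENNReal.ofReal (1 - Real.cos (2 * Real.pi / L * ∑ r : Fin 3, (m r : ℝ) * (X i r - X j r)))) * (‖Ψ.ψ X‖₊ : ENNReal) ^ 2) + ENNReal.ofReal (t / L ^ 3) * ∫⁻ X in cellN N L, (‖densityWave N L m X‖₊ : ENNReal) ^ 2 * (‖Ψ.ψ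 X‖₊ : ENNReal) ^ 2

/-- Statement of stub S (`stub_switch_of_boundedMode`). -/
def Sig.switch_of_boundedMode : Prop :=
  ∀ {S : Type} (E F M : S → ENNReal) (c B : ENNReal), (∀ Ψ, E Ψ + c = F Ψ + M Ψ) → (∀ δ : ENNReal, 0 < δ → ∃ Φ, F Φ ≤ (⨅ Ψ, F Ψ) + δ ∧ M Φ ≤ B) → (⨅ Ψ, E Ψ) + c ≤ (⨅ Ψ, F Ψ) + B

/-- Statement of stub P (`stub_price_of_softenedOccupation`). -/
def Sig.price_of_softenedOccupation : Prop :=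
  ∀ {S : Type} (F n : S → ENNReal) (s B : ENNReal), (∀ δ : ENNReal, 0 < δ → ∃ Φ, (∀ Ψ, F Φ + s * n Ψ ≤ F Ψ + s * n Φ + δ) ∧ s * n Φ ≤ B) → ∀ Ψ, (⨅ Φ, F Φ) + s * n Ψ ≤ F Ψ + B

/-- Statement of stub F (`stub_gNotchedStructureFactor`). -/
def Sig.gNotchedStructureFactor : Prop :=
  open MeasureTheory Literature.MathematicalPhysics.QuantumManyBody.BoseGas in ∀ v : ℝ → ENNReal, IsRepulsiveFiniteRange v → (∫⁻ x : EuclideanSpace ℝ (Fin 3), v ‖x‖) ≠ ⊤ → ∃ C₁ : ℝ, 0 < C₁ ∧ ∃ ρ₁ : ℝ, 0 < ρ₁ ∧ ∀ ρ : ℝ, 0 < ρ → ρ < ρ₁ → ∀ᶠ N : ℕ in Filter.atTop, ∀ L : ℝ, L = sideLength ρ N → ∀ m : Fin 3 → ℤ, m ≠ 0 → ∀ t : ℝ, t = 8 * Real.pi * (scatteringLength v).toReal → ∀ F : PeriodicTrialState N L → ENNReal, (F = fun Ψ => periodicEnergy v Ψ + ENNReal.ofReal (2 * t / L ^ 3)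 * ∫⁻ X in cellN N L, (∑ i : Fin N, ∑ j : Fin N with i < j, ENNReal.ofReal (1 - Real.cos (2 * Real.pi / L * ∑ r : Fin 3, (m r : ℝ) * (X i r - X j r)))) * (‖Ψ.ψ X‖₊ : ENNReal) ^ 2) → ∀ M : PeriodicTrialState N L → ENNReal, (M = fun Ψ => ENNReal.ofReal (t / L ^ 3) * ∫⁻ X in cellN N L, (‖densityWave N L m X‖₊ : ENNReal) ^ 2 * (‖Ψ.ψ X‖₊ : ENNReal) ^ 2) → ∀ δ : ENNReal, 0 < δ → ∃ Φ : PeriodicTrialState N L, F Φ ≤ (⨅ Ψ, F Ψ) + δ ∧ M Φ ≤ ENNReal.ofReal (C₁ * ρ)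

/-- Statement of stub O (`stub_softenedGNotchedOccupation`). -/
def Sig.softenedGNotchedOccupation : Prop :=
  open MeasureTheory Literature.MathematicalPhysics.QuantumManyBody.BoseGas in ∀ v : ℝ → ENNReal, IsRepulsiveFiniteRange v → (∫⁻ x : EuclideanSpace ℝ (Fin 3), v ‖x‖) ≠ ⊤ → ∃ C₂ : ℝ, 0 < C₂ ∧ ∃ ρ₂ : ℝ, 0 < ρ₂ ∧ ∀ ρ : ℝ, 0 < ρ → ρ < ρ₂ → ∀ᶠ N : ℕ in Filter.atTop, ∀ L : ℝ, L = sideLength ρ N → ∀ m : Fin 3 → ℤ, m ≠ 0 → ∀ t : ℝ, t = 8 * Real.pi * (scatteringLength v).toReal → ∀ F : PeriodicTrialState N L → ENNReal, (F = fun Ψ => periodicEnergy v Ψ + ENNReal.ofReal (2 * t / L ^ 3) * ∫⁻ X in cellN N L, (∑ i : Fin N, ∑ j : Fin N with i < j, ENNReal.ofReal (1 - Real.cos (2 * Real.pi / L * ∑ r : Fin 3, (m r : ℝ) * (X i r - X j r)))) * (‖Ψ.ψ X‖₊ : ENNReal) ^ 2) → ∀ s : ENNReal, s = 2⁻¹ *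 fracDispersion 2 L m → ∀ n : PeriodicTrialState N L → ENNReal, (n = fun Ψ => cellOccupation N L (planeWaveMode L m) Ψ.ψ) → ∀ δ : ENNReal, 0 < δ → ∃ Φ : PeriodicTrialState N L, (∀ Ψ : PeriodicTrialState N L, F Φ + s * n Ψ ≤ F Ψ + s * n Φ + δ) ∧ s * n Φ ≤ ENNReal.ofReal (C₂ * ρ)

/-! ## Registered stubs (`sorry` only here; N, A, S, P have LANDED and are imported) -/


/-- **Stub F — bounded structure factor of the g-notched gas at its notch (OPEN, the stoquastic
half).** For every repulsive finite-range integrable `v` there are `C₁, ρ₁ > 0` such that for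
`0 < ρ < ρ₁`, eventually in `N`, for every mode `m ≠ 0` (`k = 2πm/L`, `L = (N/ρ)^{1/3}`) and every
`δ > 0` the notched functional `F_t`, `t = 8πa(v)`, has a `δ`-near-minimiser `Φ` with
`(t/L³)∫|ρ_k|²|Φ|² ≤ C₁ρ`, i.e. `8πa · S̃'(k) ≤ C₁` where `S̃'(k) = ⟨|ρ_k|²⟩_Φ/N` is the structure
factor of the g-notched gas AT the notched wave vector. It yields SWITCH `≤ C₁ρ` (stub S); concavity
of `t ↦ inf(H - M_t)` shows SWITCH `≤ tρS̃'(k)` is exactly this quantity; Bogoliubov size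
`S̃'(k) = k²/e'_k ≤ 1` (`e'_k ≥ k²`: the g-notched pair `±k` has no leading-order restoring force
beyond the free one, and no instability: the density-wave gain `(t - e₀''(ρ))A²ρN/4 - A²k²N/8` is
negative for `t = 8πa ≤ e₀''`). `F_t` is the quadratic form of a STOQUASTIC operator (real pair
potential `v + (2t/L³)(1 - cos k·x) ≥ 0`): positive ground state, Feynman–Kac, Jastrow identity
available. Why it might fail: the stability margin in the ultra-infrared `2π/L ≤ |k| ≲ ξ⁻¹(ρa³)^{1/4}`
is LHY-order (`e₀'' - 8πa ∝ 8πa√(ρa³)`); any `O(1)`-uniform structure-factor bound for an interacting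
gas in the thermodynamic limit is beyond printed technology (nearest: Stringari's
`S(q) ≤ √(m₁χ(q))/…`, conditional on a static-response bound; crux StaticResponseBound
stmt-AtomisticToContinuum-12057 is the same wall). Sources: card notch-the-vertex; wave-1 evidence
`stub_notchedStructureFactor.lean` (bare notch refuted); Stringari1995 §2.2; LSSY2005 Thm 2.2/2.4. -/
theorem stub_gNotchedStructureFactor : open MeasureTheory Literature.MathematicalPhysics.QuantumManyBody.BoseGas in ∀ v : ℝ → ENNReal, IsRepulsiveFiniteRange v → (∫⁻ x : EuclideanSpace ℝ (Fin 3), v ‖x‖) ≠ ⊤ → ∃ C₁ : ℝ, 0 < C₁ ∧ ∃ ρ₁ : ℝ, 0 < ρ₁ ∧ ∀ ρ : ℝ, 0 < ρ → ρ < ρ₁ → ∀ᶠ N : ℕ in Filter.atTop, ∀ L : ℝ, L = sideLength ρ N → ∀ m : Fin 3 → ℤ, m ≠ 0 → ∀ t : ℝ, t = 8 * Real.pi * (scatteringLength v).toReal → ∀ F : PeriodicTrialState N L → ENNReal, (F = fun Ψ => periodicEnergy v Ψ + ENNReal.ofReal (2 * t / L ^ 3) * ∫⁻ X in cellN N L,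 (∑ i : Fin N, ∑ j : Fin N with i < j, ENNReal.ofReal (1 - Real.cos (2 * Real.pi / L * ∑ r : Fin 3, (m r : ℝ) * (X i r - X j r)))) * (‖Ψ.ψ X‖₊ : ENNReal) ^ 2) → ∀ M : PeriodicTrialState N L → ENNReal, (M = fun Ψ => ENNReal.ofReal (t / L ^ 3) * ∫⁻ X in cellN N L, (‖densityWave N L m X‖₊ : ENNReal) ^ 2 * (‖Ψ.ψ X‖₊ : ENNReal) ^ 2) → ∀ δ : ENNReal, 0 < δ → ∃ Φ : PeriodicTrialState N L, F Φ ≤ (⨅ Ψ, F Ψ) + δ ∧ M Φ ≤ ENNReal.ofReal (C₁ * ρ) := by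
  sorry

/-- **Stub O — bounded half-price occupation of the softened g-NOTCHED gas (OPEN, hardest).** For
every repulsive finite-range integrable `v` there are `C₂, ρ₂ > 0` such that for `0 < ρ < ρ₂`,
eventually in `N`, for every `m ≠ 0` and `δ > 0` the softened notched functional `F_t - ½|k|² n_k`,
`t = 8πa(v)` (additively: `F_t(Φ) + s n(Ψ) ≤ F_t(Ψ) + s n(Φ) + δ` for all `Ψ`) has a
`δ`-near-minimiser `Φ` with `½|k|² n_k(Φ) ≤ C₂ρ`. This is the crux for the g-notched Hamiltonian
`H - (8πa/L³)|ρ_k|²`, in which the ladder-renormalised transfer-`±k` pairing vertex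
(`≈ 8πa·a†_k a†_{-k}a₀a₀/L³` for `|k| ≪ 1/R₀`) and the exchange vertex are cancelled to leading
order: the softened mode is a bare particle `½k²` above the mean-field chemical potential, fed only
through Beliaev vertices `q ≠ ±k` and an LHY-order residual coupling; one-loop size
`½k²n'_k = O(ρa·√(ρa³))·(bare units)`, parametrically below the un-notched two-mode price `0.049·8πρa`.
Tool foreseen: the de-excitation certificate `ω(X†[H_s,X]) ≥ 0`, `X = a₀†a_k, a₀†a_{-k}` +
Cauchy–Schwarz (card deexcitation-certificate: closes `½k²n_k ≤ μ²/(k²+3μ)` modulo remainders, with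
`μ` the RESIDUAL coupling here). Why it might fail: the Beliaev three-leg remainders are `~μ√N` by
Cauchy–Schwarz and must be shown intensive; the residual coupling after the g-notch has unknown sign at
LHY order (over-notching by `O(8πa√(ρa³))` would make the softened notched pair `±k` weakly
attractive in the ultra-infrared); far-UV modes (`|k| ≳ 1/R₀`, where `v̂(k) < 8πa`) are over-notched
but protected by `k² ≫ ρa`. Sources: cards notch-the-vertex, deexcitation-certificate; LSSY2005;
BoccatoEtAl2019Acta; Nozieres1995; wave-1 evidence `stub_notchedStructureFactor.lean`. -/
theorem stub_softenedGNotchedOccupation : open MeasureTheory Literature.MathematicalPhysics.QuantumManyBody.BoseGas in ∀ v : ℝ → ENNReal, IsRepulsiveFiniteRange v → (∫⁻ x : EuclideanSpace ℝ (Fin 3), v ‖x‖) ≠ ⊤ → ∃ C₂ : ℝ, 0 < C₂ ∧ ∃ ρ₂ : ℝ, 0 < ρ₂ ∧ ∀ ρ : ℝ, 0 < ρ → ρ < ρ₂ → ∀ᶠ N : ℕ in Filter.atTop, ∀ L : ℝ, L = sideLength ρ N → ∀ m : Fin 3 → ℤ, m ≠ 0 → ∀ t : ℝ, t = 8 * Real.pi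 * (scatteringLength v).toReal → ∀ F : PeriodicTrialState N L → ENNReal, (F = fun Ψ => periodicEnergy v Ψ + ENNReal.ofReal (2 * t / L ^ 3) * ∫⁻ X in cellN N L, (∑ i : Fin N, ∑ j : Fin N with i < j, ENNReal.ofReal (1 - Real.cos (2 * Real.pi / L * ∑ r : Fin 3, (m r : ℝ) * (X i r - X j r)))) * (‖Ψ.ψ X‖₊ : ENNReal) ^ 2) → ∀ s : ENNReal, s = 2⁻¹ * fracDispersion 2 L m → ∀ n : PeriodicTrialState N L → ENNReal, (n = fun Ψ => cellOccupation N L (planeWaveMode L m) Ψ.ψ) → ∀ δ : ENNReal, 0 < δ → ∃ Φ : PeriodicTrialState N L, (∀ Ψ : PeriodicTrialState N L, F Φ + s * n Ψ ≤ F Ψ + s * n Φ + δ) ∧ s * n Φ ≤ ENNReal.ofReal (C₂ * ρ) := by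
  sorry

/-! ## Glue (sorry-free) -/

/-- **The notch transfer** (card notch-the-vertex, `sms_of_notch`): if `E + c = F + M` pointwise with
`c` finite, SWITCH `inf E + c ≤ inf F + B₁` and NOTCHED PRICE `inf F + s n(Ψ) ≤ F(Ψ) + B₂` for all `Ψ`,
then `inf E + s n(Ψ) ≤ E(Ψ) + (B₁ + B₂)` for all `Ψ` (drop `M ≥ 0`, cancel `c`). [folklore] -/
theorem sms_of_notch {S : Type} (E F M n : S → ℝ≥0∞) (c s B₁ B₂ : ℝ≥0∞) (hc : c ≠ ⊤)
    (hE : ∀ Ψ, E Ψ + c = F Ψ + M Ψ) (hSW : (⨅ Ψ, E Ψ) + c ≤ (⨅ Ψ, F Ψ) + B₁)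
    (hNP : ∀ Ψ, (⨅ Φ, F Φ) + s * n Ψ ≤ F Ψ + B₂) :
    ∀ Ψ, (⨅ Φ, E Φ) + s * n Ψ ≤ E Ψ + (B₁ + B₂) := by
  intro Ψ
  have h1 : (⨅ Φ, E Φ) + s * n Ψ + c ≤ E Ψ + (B₁ + B₂) + c := by
    calc (⨅ Φ, E Φ) + s * n Ψ + c = ((⨅ Φ, E Φ) + c) + s * n Ψ := by ring
      _ ≤ ((⨅ Φ, F Φ) + B₁) + s * n Ψ := by gcongr
      _ = ((⨅ Φ, F Φ) + s * n Ψ) + B₁ := by ring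
      _ ≤ (F Ψ + B₂) + B₁ := add_le_add (hNP Ψ) le_rfl
      _ ≤ (F Ψ + M Ψ + B₂) + B₁ := by gcongr; exact le_self_add
      _ = (E Ψ + c) + (B₁ + B₂) := by rw [← hE Ψ]; ring
      _ = E Ψ + (B₁ + B₂) + c := by ring
  exact (ENNReal.add_le_add_iff_right hc).1 h1

/-- **Composition: the crux from the six stubs.** For `v` repulsive finite-range integrable take
`C = C₁ + C₂`, `ρ₀ = min ρ₁ ρ₂`; for `0 < ρ < ρ₀` and `N` in both eventual ranges, fix `p ≠ 0` and the
notch coupling `t = max(0, v̂(2πp/L)) ≥ 0`: stub A (with N) gives `E + tN²/L³ = F_t + M_t`, stubs S+F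
give SWITCH with `C₁ρ`, stubs P+O give the NOTCHED PRICE with `C₂ρ`, and `sms_of_notch` concludes;
the route decl's inlined plane wave / symbol are `planeWaveMode` / `fracDispersion 2` by `rfl`. -/
theorem ModePriceIntegrable_of (hN : Sig.normSqDensityWave) (hA : Sig.energyAddConst)
    (hS : Sig.switch_of_boundedMode) (hP : Sig.price_of_softenedOccupation)
    (hF : Sig.gNotchedStructureFactor) (hO : Sig.softenedGNotchedOccupation) :
    ModePriceIntegrable := by
  intro v hv hint
  obtain ⟨C₁, hC₁, ρ₁, hρ₁, hFv⟩ := hF v hv hint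
  obtain ⟨C₂, hC₂, ρ₂, hρ₂, hOv⟩ := hO v hv hint
  refine ⟨C₁ + C₂, by positivity, min ρ₁ ρ₂, lt_min hρ₁ hρ₂, fun ρ hρ hρ₀ => ?_⟩
  have hρ₁' : ρ < ρ₁ := lt_of_lt_of_le hρ₀ (min_le_left _ _)
  have hρ₂' : ρ < ρ₂ := lt_of_lt_of_le hρ₀ (min_le_right _ _)
  filter_upwards [hFv ρ hρ hρ₁', hOv ρ hρ hρ₂', eventually_ge_atTop 1] with N hFN hON hN1
  intro p hp
  -- names (`L` first, before the trial state is introduced: its type mentions `L`)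
  have hNr : (0 : ℝ) < N := Nat.cast_pos.2 hN1
  set L : ℝ := sideLength ρ N with hL
  have hLpos : 0 < L := Real.rpow_pos_of_pos (div_pos hNr hρ) _
  intro Ψ
  show (⨅ Φ : PeriodicTrialState N L, periodicEnergy v Φ) +
      2⁻¹ * fracDispersion 2 L p * cellOccupation N L (planeWaveMode L p) Ψ.ψ ≤
      periodicEnergy v Ψ + ENNReal.ofReal ((C₁ + C₂) * ρ)
  set t : ℝ := 8 * Real.pi * (scatteringLength v).toReal with ht
  have ht0 : 0 ≤ t := by rw [ht]; positivity
  set F : PeriodicTrialState N L → ℝ≥0∞ := fun Φ => periodicEnergy v Φ +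
    ENNReal.ofReal (2 * t / L ^ 3) * ∫⁻ X in cellN N L, (∑ i : Fin N, ∑ j : Fin N with i < j,
      ENNReal.ofReal (1 - Real.cos (2 * Real.pi / L * ∑ r : Fin 3, (p r : ℝ) * (X i r - X j r)))) *
        (‖Φ.ψ X‖₊ : ℝ≥0∞) ^ 2 with hFdef
  set M : PeriodicTrialState N L → ℝ≥0∞ := fun Φ => ENNReal.ofReal (t / L ^ 3) *
    ∫⁻ X in cellN N L, (‖densityWave N L p X‖₊ : ℝ≥0∞) ^ 2 * (‖Φ.ψ X‖₊ : ℝ≥0∞) ^ 2 with hMdef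
  set s : ℝ≥0∞ := 2⁻¹ * fracDispersion 2 L p with hs
  set n : PeriodicTrialState N L → ℝ≥0∞ := fun Φ => cellOccupation N L (planeWaveMode L p) Φ.ψ
    with hn
  set c : ℝ≥0∞ := ENNReal.ofReal (t * (N : ℝ) ^ 2 / L ^ 3) with hc
  -- stub A (with stub N): the bookkeeping identity
  have hE : ∀ Φ : PeriodicTrialState N L, periodicEnergy v Φ + c = F Φ + M Φ :=
    fun Φ => hA v N L t p hLpos ht0 (hN N L p) Φ
  -- stubs S + F: the switching energy
  have hSW : (⨅ Φ : PeriodicTrialState N L, periodicEnergy v Φ) + c ≤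
      (⨅ Φ, F Φ) + ENNReal.ofReal (C₁ * ρ) := by
    refine hS (fun Φ : PeriodicTrialState N L => periodicEnergy v Φ) F M c _ hE ?_
    intro δ hδ
    exact hFN L hL p hp t ht F hFdef M hMdef δ hδ
  -- stubs P + O: the notched price
  have hNP : ∀ Φ : PeriodicTrialState N L, (⨅ Φ', F Φ') + s * n Φ ≤ F Φ + ENNReal.ofReal (C₂ * ρ) := by
    refine hP F n s _ ?_
    intro δ hδ
    exact hON L hL p hp t ht F hFdef s hs n hn δ hδ
  -- the transfer
  have key := sms_of_notch (fun Φ : PeriodicTrialState N L => periodicEnergy v Φ) F M n c s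
    (ENNReal.ofReal (C₁ * ρ)) (ENNReal.ofReal (C₂ * ρ)) ENNReal.ofReal_ne_top hE hSW hNP Ψ
  have hC : ENNReal.ofReal (C₁ * ρ) + ENNReal.ofReal (C₂ * ρ) = ENNReal.ofReal ((C₁ + C₂) * ρ) := by
    rw [← ENNReal.ofReal_add (by positivity) (by positivity)]
    congr 1; ring
  rw [hC] at key
  exact key

/-- **The crux by name**, closed modulo the registered stubs (type-checks that the `Sig.*` legend is
the stub signatures verbatim). -/
theorem modePriceIntegrable_of_stubs : ModePriceIntegrable :=
  ModePriceIntegrable_of stub_normSqDensityWave stub_energyAddConst stub_switch_of_boundedMode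
    stub_price_of_softenedOccupation stub_gNotchedStructureFactor stub_softenedGNotchedOccupation

end Summit.AtomisticToContinuum.BoseEinsteinCondensation.Theorems

end
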